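import Literature.NumberTheory.GaloisRepresentations.AlgebraicHeckeCharacterGrossencharakterProofs
import Mathlib.RingTheory.RootsOfUnity.Complex
import HarnessLib

/-!
# A cube root of an algebraic Hecke character of weight divisible by `3` is algebraic
(crux `IrreducibilityBySelfDuality.RegularAdjointLiftCM`, item stmt-Langlands-13617, line
`nu-cubed-central-character`, stub `stub_cubeRootAlgebraic`)

Let `K` be a number field and `χ, ω` Hecke characters of `K` with `χ³ = ω`, where `ω` has infinity
type `(p, q)` (`HeckeCharacter.HasInfinityType`: `ω((x, 1)) = A_{p,q}(x) :=
∏_w ι_w(x_w)^{-p_w} \overline{ι_w(x_w)}^{-q_w}` for `x` near `1` in `(K ⊗ ℝ)ˣ`) with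
`3 ∣ p_w + q_w` at every infinite place `w`.  Then `χ` is algebraic (Weil's type `A₀`,
`HeckeCharacter.IsAlgebraic`), of infinity type `(p_w/3, q_w/3)` at the complex places and
`((p_w + q_w)/3, 0)` at the real ones.  This is pure `GL(1)`:

* `three_dvd_sub_of_pow_three_eq` — **at a complex place `w`, `3 ∣ q_w - p_w`.**  The infinite
  idele `x(y)` with `y ∈ K_wˣ` in the slot `w` and `1` elsewhere is totally positive (no real
  coordinate is touched), so the infinity-type formula holds at it on the nose
  (`HasInfinityType.apply_infiniteIdeles_eq`): `ω(x(y)) = ι_w(y)^{-p_w} \overline{ι_w(y)}^{-q_w}`.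
  Take `ι_w(y) = ζ₃` a primitive cube root of unity (`K_w ≅ ℂ`): `x(y)³ = 1`, so
  `1 = χ(x(y))³ = ω(x(y)) = ζ₃^{-p_w} ζ₃^{q_w}` (`\bar ζ₃ = ζ₃⁻¹`), whence `3 ∣ q_w - p_w`; with
  `3 ∣ p_w + q_w` this gives `3 ∣ p_w` and `3 ∣ q_w`.
* `archFactor_eq_pow_three` — with `p' = (p+q)/3, q' = 0` at real places (where
  `\overline{ι_w} = ι_w`, so only `p_w + q_w` matters) and `p' = p/3, q' = q/3` at complex ones,
  `A_{p,q} = A_{p',q'}³` on all of `(K ⊗ ℝ)ˣ`.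
* `stub_cubeRootAlgebraic` — `g(x) := χ((x,1)) / A_{p',q'}(x)` is continuous on `(K ⊗ ℝ)ˣ`
  (`continuous_archFactor`), `g(1) = 1`, and `g³ = 1` near `1`; the cube roots of unity `≠ 1`
  form a finite, hence closed, set, so `g = 1` near `1`, i.e. `χ` has infinity type `(p', q')`
  (the argument of the tree's `HeckeCharacter.IsFiniteOrder.isAlgebraic`).

References: A. Weil, *On a certain type of characters of the idèle-class group of an algebraic
number-field* (1956), §1 (type `A₀`); J. Neukirch, *Algebraic Number Theory* (1999), Ch. VII §6,
(6.7)–(6.9) (infinity types; at a real place the type is `ι_w^{p}`, at a complex one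
`ι_w^{p} \bar ι_w^{q}`).
-/

noncomputable section

open scoped BigOperators Topology Classical ComplexConjugate
open Filter Set Function IsDedekindDomain NumberField
open NumberField.InfinitePlace.Completion
open Literature.NumberTheory.Automorphic
open Literature.NumberTheory.GaloisRepresentations (HeckeCharacter ideleGroup infiniteIdeles)
open Literature.NumberTheory.GaloisRepresentations (InfiniteIdele.IsTotallyPositive
  InfiniteIdele.extensionEmbedding_apply_ne_zero)

set_option linter.dupNamespace false -- project-wide option (lakefile weak.linter.dupNamespace); `Summit.Langlands.Langlands` is the mandated namespace

namespace Summit.Langlands.Langlands.Theorems.RegularAdjointLiftCM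

section Helpers

variable {K : Type*} [Field K]

/-! ### Infinite ideles supported at one place -/

/-- An infinite idele supported at a COMPLEX place `w` (all other coordinates `1`) is totally
positive: its coordinates at the real places are `1 > 0`. [folklore] -/
theorem isTotallyPositive_of_eq_one_of_ne {w : InfinitePlace K} (hw : w.IsComplex)
    {x : (InfiniteAdeleRing K)ˣ} (hx : ∀ w', w' ≠ w → (x : InfiniteAdeleRing K) w' = 1) :
    InfiniteIdele.IsTotallyPositive x := by
  intro w' hw'
  have hne : w' ≠ w := fun h => InfinitePlace.not_isReal_iff_isComplex.mpr hw (h ▸ hw')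
  rw [hx w' hne, map_one]
  exact one_pos

/-- **An infinite idele supported at `w` with prescribed coordinate.**  For `y ∈ K_wˣ` there is
`x ∈ (K ⊗ ℝ)ˣ` with `x_w = y`, `x_{w'} = 1` for `w' ≠ w`, and `x³ = 1` as soon as `y³ = 1`
(`x = Units.map (MonoidHom.mulSingle _ w) y`). [folklore] -/
theorem exists_infiniteIdele_eq_one_of_ne (w : InfinitePlace K) (y : (w.Completion)ˣ) :
    ∃ x : (InfiniteAdeleRing K)ˣ, (x : InfiniteAdeleRing K) w = y ∧
      (∀ w', w' ≠ w → (x : InfiniteAdeleRing K) w' = 1) ∧ (y ^ 3 = 1 → x ^ 3 = 1) := by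
  let F : w.Completion →* InfiniteAdeleRing K :=
    MonoidHom.mulSingle (fun v : InfinitePlace K => v.Completion) w
  refine ⟨Units.map F y, ?_, fun w' hw' => ?_, fun hy3 => ?_⟩
  · exact Pi.mulSingle_eq_same (M := fun v : InfinitePlace K => v.Completion) w (y : w.Completion)
  · exact Pi.mulSingle_eq_of_ne (M := fun v : InfinitePlace K => v.Completion) hw'
      (y : w.Completion)
  · rw [← map_pow, hy3, map_one]

variable [NumberField K]

/-- The archimedean factor of an infinite idele `x` supported at the place `w`:
`A_{p,q}(x) = ι_w(x_w)^{-p_w} \overline{ι_w(x_w)}^{-q_w}` (all other factors are `1`).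
[folklore] -/
theorem archFactor_of_eq_one_of_ne (p q : InfinitePlace K → ℤ) {w : InfinitePlace K}
    {x : (InfiniteAdeleRing K)ˣ} (hx : ∀ w', w' ≠ w → (x : InfiniteAdeleRing K) w' = 1) :
    HeckeCharacter.archFactor p q x =
      extensionEmbedding w ((x : InfiniteAdeleRing K) w) ^ (-p w) *
        conj (extensionEmbedding w ((x : InfiniteAdeleRing K) w)) ^ (-q w) := by
  rw [HeckeCharacter.archFactor_apply]
  refine Finset.prod_eq_single w (fun w' _ hw' => ?_) fun h => absurd (Finset.mem_univ w) h
  rw [hx w' hw', map_one, map_one, one_zpow, one_zpow, mul_one]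

/-! ### Step 1: `3 ∣ q_w - p_w` at a complex place -/

/-- **The cube of a Hecke character has infinity type `≡ (p, p) mod 3` at the complex places.**
If `χ³ = ω` and `ω` has infinity type `(p, q)`, then `3 ∣ q_w - p_w` at every complex place `w`:
evaluate at the (totally positive) infinite idele `x` with `ι_w(x_w) = ζ₃` a primitive cube root
of unity and `x_{w'} = 1` elsewhere — `x³ = 1`, so
`1 = χ(x)³ = ω(x) = ζ₃^{-p_w} \bar ζ₃^{-q_w} = ζ₃^{q_w - p_w}`.  Weil 1956, §1 (the infinity type
of a character is trivial on the roots of unity of `K_w`). [folklore] -/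
theorem three_dvd_sub_of_pow_three_eq {χ ω : HeckeCharacter K} {p q : InfinitePlace K → ℤ}
    (h3 : χ ^ 3 = ω) (hω : ω.HasInfinityType p q) {w : InfinitePlace K} (hw : w.IsComplex) :
    (3 : ℤ) ∣ q w - p w := by
  obtain ⟨ζ, hζ⟩ : ∃ ζ : ℂ, IsPrimitiveRoot ζ 3 := ⟨_, Complex.isPrimitiveRoot_exp 3 (by norm_num)⟩
  have hζ0 : ζ ≠ 0 := hζ.ne_zero (by norm_num)
  -- a unit `y` of `K_w` with `ι_w(y) = ζ`, `y³ = 1`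
  obtain ⟨y, hyζ, hy3⟩ : ∃ y : (w.Completion)ˣ,
      extensionEmbedding w (y : w.Completion) = ζ ∧ y ^ 3 = 1 := by
    have hne : (ringEquivComplexOfIsComplex hw).symm ζ ≠ 0 :=
      (RingEquiv.map_ne_zero_iff _).mpr hζ0
    refine ⟨Units.mk0 _ hne, ?_, Units.ext ?_⟩
    · rw [Units.val_mk0, ← ringEquivComplexOfIsComplex_apply hw, RingEquiv.apply_symm_apply]
    · rw [Units.val_pow_eq_pow_val, Units.val_mk0, ← map_pow, hζ.pow_eq_one, map_one,
        Units.val_one]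
  -- the infinite idele `x` supported at `w` with `x_w = y`
  obtain ⟨x, hxw, hx, hx3⟩ := exists_infiniteIdele_eq_one_of_ne w y
  have h1 : ((ω (infiniteIdeles K x) : ℂˣ) : ℂ) = ζ ^ (-p w) * conj ζ ^ (-q w) := by
    rw [hω.apply_infiniteIdeles_eq (isTotallyPositive_of_eq_one_of_ne hw hx),
      archFactor_of_eq_one_of_ne p q hx, hxw, hyζ]
  have h2 : ((ω (infiniteIdeles K x) : ℂˣ) : ℂ) = 1 := by
    rw [← h3, HeckeCharacter.pow_apply, ← map_pow χ, ← map_pow (infiniteIdeles K), hx3 hy3,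
      map_one, map_one, Units.val_one]
  rw [h2, ← Complex.inv_eq_conj (hζ.norm'_eq_one (by norm_num)), inv_zpow', neg_neg,
    ← zpow_add₀ hζ0] at h1
  have h4 : ((3 : ℕ) : ℤ) ∣ -p w + q w := (hζ.zpow_eq_one_iff_dvd _).mp h1.symm
  omega

/-! ### Step 2: `A_{p,q} = A_{p',q'}³` -/

/-- Powers of a local factor: `(a^{-p} b^{-q})ⁿ = a^{-pn} b^{-qn}`. [folklore] -/
theorem localFactor_pow (a b : ℂ) (p q : ℤ) (n : ℕ) :
    (a ^ (-p) * b ^ (-q)) ^ n = a ^ (-(p * n)) * b ^ (-(q * n)) := by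
  rw [mul_pow, ← zpow_natCast, ← zpow_natCast, ← zpow_mul, ← zpow_mul, neg_mul, neg_mul]

omit [NumberField K] in
/-- **At a real place the local factor depends only on `p + q`**: `ι_w` is real-valued there
(`extensionEmbeddingOfIsReal_apply`), so `\overline{ι_w(x_w)} = ι_w(x_w)` and
`ι_w(x_w)^{-p} \overline{ι_w(x_w)}^{-q} = ι_w(x_w)^{-(p+q)}`.  Neukirch, *Algebraic Number Theory*,
Ch. VII §6 (6.7) (real places carry a single exponent). [folklore] -/
theorem localFactor_of_isReal {w : InfinitePlace K} (hw : w.IsReal) (x : (InfiniteAdeleRing K)ˣ)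
    (p q : ℤ) :
    extensionEmbedding w ((x : InfiniteAdeleRing K) w) ^ (-p) *
        conj (extensionEmbedding w ((x : InfiniteAdeleRing K) w)) ^ (-q) =
      extensionEmbedding w ((x : InfiniteAdeleRing K) w) ^ (-(p + q)) := by
  have hreal : conj (extensionEmbedding w ((x : InfiniteAdeleRing K) w)) =
      extensionEmbedding w ((x : InfiniteAdeleRing K) w) := by
    rw [← extensionEmbeddingOfIsReal_apply hw, Complex.conj_ofReal]
  rw [hreal, ← zpow_add₀ (InfiniteIdele.extensionEmbedding_apply_ne_zero x w), neg_add]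

/-- **`A_{p,q} = A_{p',q'}³`** when `3 ∣ p_w + q_w` at the real places and `3 ∣ p_w`, `3 ∣ q_w`
at the complex ones, with `p' = (p+q)/3, q' = 0` (real) and `p' = p/3, q' = q/3` (complex):
factor by factor (`localFactor_pow`, `localFactor_of_isReal`). [folklore] -/
theorem archFactor_eq_pow_three {p q : InfinitePlace K → ℤ}
    (hdiv : ∀ w : InfinitePlace K, (3 : ℤ) ∣ p w + q w)
    (hcx : ∀ w : InfinitePlace K, ¬ w.IsReal → (3 : ℤ) ∣ p w ∧ (3 : ℤ) ∣ q w)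
    (x : (InfiniteAdeleRing K)ˣ) :
    HeckeCharacter.archFactor p q x =
      HeckeCharacter.archFactor (fun w => if w.IsReal then (p w + q w) / 3 else p w / 3)
        (fun w => if w.IsReal then 0 else q w / 3) x ^ 3 := by
  rw [HeckeCharacter.archFactor_apply, HeckeCharacter.archFactor_apply, ← Finset.prod_pow]
  refine Finset.prod_congr rfl fun w _ => ?_
  rw [localFactor_pow, Nat.cast_ofNat]
  by_cases hw : w.IsReal
  · rw [if_pos hw, if_pos hw, localFactor_of_isReal hw x (p w) (q w), localFactor_of_isReal hw x,
      zero_mul, add_zero, Int.ediv_mul_cancel (hdiv w)]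
  · obtain ⟨hp, hq⟩ := hcx w hw
    rw [if_neg hw, if_neg hw, Int.ediv_mul_cancel hp, Int.ediv_mul_cancel hq]

/-! ### Step 3: continuity and non-vanishing of `A_{p,q}` -/

/-- The archimedean factor `A_{p,q}` never vanishes on `(K ⊗ ℝ)ˣ` (each `ι_w(x_w) ≠ 0`).
[folklore] -/
theorem archFactor_ne_zero (p q : InfinitePlace K → ℤ) (x : (InfiniteAdeleRing K)ˣ) :
    HeckeCharacter.archFactor p q x ≠ 0 := by
  rw [HeckeCharacter.archFactor_apply]
  exact Finset.prod_ne_zero_iff.mpr fun w _ => mul_ne_zero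
    (zpow_ne_zero _ (InfiniteIdele.extensionEmbedding_apply_ne_zero x w))
    (zpow_ne_zero _ ((map_ne_zero _).mpr (InfiniteIdele.extensionEmbedding_apply_ne_zero x w)))

/-- The embedding of the infinite ideles `(K ⊗ ℝ)ˣ ↪ 𝕀_K`, `x ↦ (x, 1)`, is continuous
(`Units.map` of the continuous `MonoidHom.inl`). [folklore] -/
theorem continuous_infiniteIdeles :
    Continuous (infiniteIdeles K : (InfiniteAdeleRing K)ˣ → ideleGroup K) :=
  Continuous.units_map _ (continuous_id.prodMk continuous_const)

/-- **The archimedean factor `A_{p,q} : (K ⊗ ℝ)ˣ → ℂ` is continuous**: a finite product of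
integer powers of the continuous nonvanishing maps `x ↦ ι_w(x_w)` (`isometry_extensionEmbedding`)
and their conjugates. [folklore] -/
theorem continuous_archFactor (p q : InfinitePlace K → ℤ) :
    Continuous (HeckeCharacter.archFactor p q : (InfiniteAdeleRing K)ˣ → ℂ) := by
  have hc : ∀ w : InfinitePlace K, Continuous fun x : (InfiniteAdeleRing K)ˣ =>
      extensionEmbedding w ((x : InfiniteAdeleRing K) w) := fun w =>
    (isometry_extensionEmbedding w).continuous.comp ((continuous_apply w).comp Units.continuous_val)
  have heq : (HeckeCharacter.archFactor p q : (InfiniteAdeleRing K)ˣ → ℂ) =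
      fun x : (InfiniteAdeleRing K)ˣ => ∏ w : InfinitePlace K,
        extensionEmbedding w ((x : InfiniteAdeleRing K) w) ^ (-p w) *
          conj (extensionEmbedding w ((x : InfiniteAdeleRing K) w)) ^ (-q w) :=
    funext (HeckeCharacter.archFactor_apply p q)
  rw [heq]
  refine continuous_finsetProd _ fun w _ => ?_
  exact ((hc w).zpow₀ _ fun x => Or.inl (InfiniteIdele.extensionEmbedding_apply_ne_zero x w)).mul
    ((Complex.continuous_conj.comp (hc w)).zpow₀ _ fun x =>
      Or.inl ((map_ne_zero _).mpr (InfiniteIdele.extensionEmbedding_apply_ne_zero x w)))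

end Helpers

/-! ### The registered stub -/

/-- **Stub `stub_cubeRootAlgebraic`** of the line `nu-cubed-central-character` for the crux
`RegularAdjointLiftCM` (**a cube root of an algebraic Hecke character of weight divisible by `3`
is algebraic**).  If `χ³ = ω`, `ω` has infinity type `(p, q)` and `3 ∣ p_w + q_w` at every
infinite place, then `χ` is algebraic — of infinity type `p' = (p+q)/3, q' = 0` at the real places
and `p' = p/3, q' = q/3` at the complex ones (`three_dvd_sub_of_pow_three_eq` makes these
integers): on the neighbourhood of `1` where `ω = A_{p,q} = A_{p',q'}³` (`archFactor_eq_pow_three`)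
the continuous function `g = χ((·,1)) / A_{p',q'}` (`continuous_archFactor`,
`continuous_infiniteIdeles`) takes values in the cube roots of unity and `g(1) = 1`; the cube roots
of unity `≠ 1` form a finite closed set avoided by `g` near `1`, so `g = 1` near `1`.
Weil 1956, §1 (type `A₀`); Neukirch, *Algebraic Number Theory*, Ch. VII §6 (6.7)–(6.9).
[folklore] -/
theorem stub_cubeRootAlgebraic :
    ∀ (K : Type) [Field K] [NumberField K] (χ ω : HeckeCharacter K) (p q : InfinitePlace K → ℤ),
      χ ^ 3 = ω → ω.HasInfinityType p q → (∀ w : InfinitePlace K, (3 : ℤ) ∣ p w + q w) →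
        χ.IsAlgebraic := by
  intro K _ _ χ ω p q h3 hω hdiv
  -- Step 1: `3 ∣ p_w` and `3 ∣ q_w` at the complex places
  have hcx : ∀ w : InfinitePlace K, ¬ w.IsReal → (3 : ℤ) ∣ p w ∧ (3 : ℤ) ∣ q w := fun w hw => by
    have h := three_dvd_sub_of_pow_three_eq h3 hω (InfinitePlace.not_isReal_iff_isComplex.mp hw)
    have h' := hdiv w
    constructor <;> omega
  -- Step 2: the infinity type `(p', q')` of `χ`, `A_{p,q} = A_{p',q'}³`
  set p' : InfinitePlace K → ℤ := fun w => if w.IsReal then (p w + q w) / 3 else p w / 3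
  set q' : InfinitePlace K → ℤ := fun w => if w.IsReal then 0 else q w / 3
  have hcube : ∀ x, HeckeCharacter.archFactor p q x = HeckeCharacter.archFactor p' q' x ^ 3 :=
    archFactor_eq_pow_three hdiv hcx
  rw [HeckeCharacter.isAlgebraic_iff_exists_hasInfinityType]
  refine ⟨p', q', ?_⟩
  obtain ⟨U, hU, hωU⟩ := hω
  -- Step 3: `g = χ((·,1)) / A_{p',q'}` is continuous, `g(1) = 1`, `g³ = 1` on `U`
  set g : (InfiniteAdeleRing K)ˣ → ℂ := fun x =>
    ((χ (infiniteIdeles K x) : ℂˣ) : ℂ) / HeckeCharacter.archFactor p' q' x with hg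
  have hgc : Continuous g :=
    (Units.continuous_val.comp ((map_continuous χ).comp continuous_infiniteIdeles)).div
      (continuous_archFactor p' q') (archFactor_ne_zero p' q')
  have hg1 : g 1 = 1 := by
    simp only [hg, map_one, Units.val_one, div_one]
  have hg3 : ∀ x ∈ U, g x ^ 3 = 1 := fun x hx => by
    simp only [hg]
    rw [div_pow, ← hcube, ← Units.val_pow_eq_pow_val, ← HeckeCharacter.pow_apply, h3, hωU x hx,
      div_self (archFactor_ne_zero p q x)]
  -- the cube roots of unity `≠ 1` form a finite closed set avoided by `g` near `1`
  -- (adapted from `HeckeCharacter.IsFiniteOrder.isAlgebraic`, `WeakAbelianDirectSummandProofs`)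
  set S : Set ℂ := {z | z ^ 3 = 1 ∧ z ≠ 1}
  have hSfin : S.Finite := by
    refine (Multiset.finite_toSet (Polynomial.nthRoots 3 (1 : ℂ))).subset fun z hz => ?_
    simp only [Set.mem_setOf_eq] at hz ⊢
    exact (Polynomial.mem_nthRoots (by norm_num)).mpr hz.1
  have h1S : (1 : (InfiniteAdeleRing K)ˣ) ∈ g ⁻¹' Sᶜ := fun h => h.2 hg1
  have hV : g ⁻¹' Sᶜ ∈ 𝓝 (1 : (InfiniteAdeleRing K)ˣ) :=
    (hSfin.isClosed.isOpen_compl.preimage hgc).mem_nhds h1S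
  refine ⟨U ∩ g ⁻¹' Sᶜ, inter_mem hU hV, fun x hx => ?_⟩
  have hx' : g x ∉ S := hx.2
  have hgx : g x = 1 := by
    by_contra hne
    exact hx' ⟨hg3 x hx.1, hne⟩
  exact (div_eq_one_iff_eq (archFactor_ne_zero p' q' x)).mp hgx

end Summit.Langlands.Langlands.Theorems.RegularAdjointLiftCM

end
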